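import Literature.Probability.LatticeModels.CoarseCellFiniteSize
import HarnessLib

/-!
# Coarse cells with HYPEREDGE defects: vocabulary of the two-species finite-size conditions

Companion definitions file of `CoarseCellFiniteSize.lean`. The Dobrushin–Shlosman /
van den Berg–Maes engine with Peierls-rare defects (`CoarseCellMixingDefects*`,
`influence_decay_markov_defects`) treats ONE defect species: bad CELLS of a block-Markov
specification. Dressing a Markov Gibbs measure by a Kotecký–Preiss-small quasi-local polymer
interaction and decoupling each far polymer into a Bernoulli MARK (an auxiliary site whose value is
"active" or not; `QuasiLocalGaugePerturbationDecoupling*`) produces a joint system with a SECOND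
defect species: active marks, i.e. active HYPEREDGES linking all the cells of the polymer's
TERRITORY. This file fixes the vocabulary in which the two-species engine is stated. Every site
`v` of the configuration space `V → S` carries

* a home cell `cell v` (meaningful for ordinary sites),
* a TERRITORY `terr v : Finset (CoarseIdx μ)` (ordinary sites: `{cell v}`; marks: the cells of
  the polymer),
* an ACTIVITY EVENT `act v : Set S` (ordinary sites: `∅`; marks: "the mark is on"),

and the engine resamples, for a set `A` of cells, the JOINT VOLUME `hvol terr A` of the sites whose
whole territory lies in `A`. Definitions:

* `hvol`, `NoCrossing` (no ACTIVE exterior hyperedge meets `A`);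
* `IsHyperMarkov` — exact locality of the kernel of `hvol terr A` in the exterior ordinary sites
  at coarse distance `≤ 1` from `A`, for exteriors without active crossing hyperedges (the values
  of exterior marks are never read);
* `IsGoodFSHyper` — the good-exterior finite-size condition of `IsGoodFS`, asked only for
  exteriors without active crossing hyperedges, for observables of the ORDINARY sites of the
  central cell, with goodness cell-local in the ordinary sites;
* `HyperPeierls` — the two-species kernel-uniform Peierls bound: all cells of `D` bad AND all
  marks of `M` active costs `q^{|D|} ∏_{v ∈ M} r_v`, uniformly in the volume and in the exterior
  (good next to `D`, no active crossing hyperedge); `MarkRarity` — the unconditional form for the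
  marks alone (any volume, any exterior).

With `terr v = {cell v}` and `act v = ∅` for every site these are the block-Markov property,
`IsGoodFS` and `UniformKernelPeierls` of the one-species series (the mark set `M` being priced by
`∏ r_v` with an empty activity event, i.e. only `M = ∅` matters).

Sources: R. L. Dobrushin, S. B. Shlosman (1985), §2 (finite-size conditions); J. van den Berg,
C. Maes, Ann. Probab. 22 (1994) (disagreement percolation with defects); R. Kotecký, D. Preiss,
CMP 103 (1986) (polymer weights); R. G. Edwards, A. D. Sokal, Phys. Rev. D 38 (1988) (joint
spin/bond systems). The combination (hyperedge defects from a decoupled dressing) is folklore-level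
bookkeeping; no theorem is claimed here.
-/

open MeasureTheory

namespace Literature.Probability.LatticeModels

variable {d : ℕ} {μ : Fin d → ℕ} {V S : Type*} [MeasurableSpace S]

/-! ### Joint volumes and crossing hyperedges -/

/-- **The joint volume of a set of cells**: the sites whose whole territory lies in `A` (ordinary
sites homed in `A`, and the marks of the polymers inside `A`). [cite: DobrushinShlosman1985, §2] -/
def hvol [Fintype V] (terr : V → Finset (CoarseIdx μ)) (A : Finset (CoarseIdx μ)) : Finset V :=
  Finset.univ.filter fun v => terr v ⊆ A

/-- Membership in the joint volume. [folklore] -/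
@[simp] theorem mem_hvol [Fintype V] {terr : V → Finset (CoarseIdx μ)} {A : Finset (CoarseIdx μ)}
    {v : V} : v ∈ hvol terr A ↔ terr v ⊆ A := by
  simp [hvol]

/-- **No active hyperedge crosses the boundary of `A`** in the configuration `σ`: every site
outside the joint volume of `A` whose territory meets `A` is inactive. [cite: BergMaes1994, §2] -/
def NoCrossing [Fintype V] (terr : V → Finset (CoarseIdx μ)) (act : V → Set S)
    (A : Finset (CoarseIdx μ)) (σ : V → S) : Prop :=
  ∀ v, ¬ terr v ⊆ A → (∃ c ∈ terr v, c ∈ A) → σ v ∉ act v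

/-! ### The hyper-Markov property -/

/-- **Hyper-Markov property** of a specification with territories and activity events: for every
set `A` of cells, two exteriors that agree on the ORDINARY sites (`act v = ∅`) homed within coarse
distance `1` of `A` and have no active crossing hyperedge give the same kernel expectation, on the
joint volume of `A`, to every `[0,1]`-valued measurable observable reading only resampled sites and
agreeing sites (exact locality; the values of exterior marks are never read, inactive crossing
polymers are absent from the interaction). [cite: Georgii2011, Ch. 8] -/
def IsHyperMarkov [Fintype V] (cell : V → CoarseIdx μ) (terr : V → Finset (CoarseIdx μ))
    (act : V → Set S) (γ : Specification V S) : Prop :=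
  ∀ (A : Finset (CoarseIdx μ)) (ζ ζ' : V → S),
    (∀ v, act v = ∅ → ¬ terr v ⊆ A → (∃ a ∈ A, cdist a (cell v) ≤ 1) → ζ v = ζ' v) →
    NoCrossing terr act A ζ → NoCrossing terr act A ζ' →
    ∀ f : (V → S) → ℝ, Measurable f → (∀ σ, 0 ≤ f σ ∧ f σ ≤ 1) →
      DependsOn f {v | v ∈ hvol terr A ∨ ζ v = ζ' v} →
      ∫ σ, f σ ∂(γ (hvol terr A) ζ) = ∫ σ, f σ ∂(γ (hvol terr A) ζ')

/-! ### The good-exterior finite-size condition, hyper form -/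

/-- **Good-exterior finite-size condition with hyperedges** at window `n` and threshold `ε`:
`good c` is measurable and cell-local in the ORDINARY sites of `c`, and for every set `A` of cells
inside the cube of `(4n+1)^d` cells centred at `c`, every two exteriors that agree on the ordinary
sites of the cube, are good on the cube-and-shell cells outside `A` and have no active hyperedge
crossing the boundary of `A`, and every `[0,1]`-valued measurable observable of the ordinary sites
of the central cell, the kernel expectations on the joint volume of `A` differ by at most `ε`
(`IsGoodFS` when all territories are singletons and all activity events empty).
[cite: DobrushinShlosman1985, §2] -/
structure IsGoodFSHyper [Fintype V] (cell : V → CoarseIdx μ) (terr : V → Finset (CoarseIdx μ))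
    (act : V → Set S) (γ : Specification V S) (good : CoarseIdx μ → Set (V → S)) (n : ℕ)
    (ε : ℝ) : Prop where
  good_local : ∀ (c : CoarseIdx μ) (σ τ : V → S),
    (∀ v, act v = ∅ → cell v = c → σ v = τ v) → (σ ∈ good c ↔ τ ∈ good c)
  good_meas : ∀ c, MeasurableSet (good c)
  fs : ∀ (c : CoarseIdx μ) (A : Finset (CoarseIdx μ)), (∀ a ∈ A, cdist c a ≤ 2 * n) →
    ∀ ζ ζ' : V → S, (∀ v, act v = ∅ → cdist c (cell v) ≤ 2 * n → ζ v = ζ' v) →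
      (∀ c', cdist c c' ≤ 2 * n + 1 → c' ∉ A → ζ ∈ good c' ∧ ζ' ∈ good c') →
      NoCrossing terr act A ζ → NoCrossing terr act A ζ' →
      ∀ f : (V → S) → ℝ, Measurable f → (∀ σ, 0 ≤ f σ ∧ f σ ≤ 1) →
        DependsOn f {v | act v = ∅ ∧ cell v = c} →
        |∫ σ, f σ ∂(γ (hvol terr A) ζ) - ∫ σ, f σ ∂(γ (hvol terr A) ζ')| ≤ ε

/-! ### The two-species kernel-uniform Peierls bound -/

/-- **Two-species kernel-uniform Peierls bound** at levels `q` (bad cells) and `r` (active marks):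
for every set `A` of cells, every exterior `ζ` without active crossing hyperedge, every set `D`
of cells each of whose `cdist ≤ 1` neighbours lies in `A` or is good in `ζ`, and every set `M` of
sites of the joint volume of `A`, the kernel probability that ALL cells of `D` are bad and ALL
sites of `M` are active is at most `q^{|D|} ∏_{v ∈ M} r_v` (`UniformKernelPeierls` when `M = ∅`;
the second species is priced per OBJECT, as in a Kotecký–Preiss polymer weight).
[cite: Georgii2011, §6.2] -/
def HyperPeierls [Fintype V] (terr : V → Finset (CoarseIdx μ)) (act : V → Set S)
    (γ : Specification V S) (good : CoarseIdx μ → Set (V → S)) (q : ℝ) (r : V → ℝ) : Prop :=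
  ∀ (A : Finset (CoarseIdx μ)) (ζ : V → S), NoCrossing terr act A ζ →
    ∀ (D : Finset (CoarseIdx μ)) (M : Finset V),
      (∀ c ∈ D, ∀ c' : CoarseIdx μ, cdist c c' ≤ 1 → c' ∈ A ∨ ζ ∈ good c') →
      M ⊆ hvol terr A →
      γ (hvol terr A) ζ ({σ | ∀ c ∈ D, σ ∉ good c} ∩ {σ | ∀ v ∈ M, σ v ∈ act v}) ≤
        ENNReal.ofReal (q ^ D.card * ∏ v ∈ M, r v)

/-! ### Unconditional rarity of active marks -/

/-- **Kernel-uniform rarity of active marks, unconditional form**: resampling ANY finite volume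
`Λ` with ANY exterior, the sites of `M ⊆ Λ` are all active with kernel probability at most
`∏_{v ∈ M} r_v` (for the Bernoulli marks of a decoupled dressing this is the conditional
independence of the marks given everything else; ordinary sites, whose activity event is empty,
make both sides trivial unless `r ≥ 0`). [cite: Georgii2011, §6.2] -/
def MarkRarity [Fintype V] (act : V → Set S) (γ : Specification V S) (r : V → ℝ) : Prop :=
  ∀ (Λ : Finset V) (ζ : V → S) (M : Finset V), M ⊆ Λ →
    γ Λ ζ {σ | ∀ v ∈ M, σ v ∈ act v} ≤ ENNReal.ofReal (∏ v ∈ M, r v)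

end Literature.Probability.LatticeModels
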